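import Summits.ABC.IUTFork.Cor312SettingMSharpInvariance
import Summits.ABC.IUTFork.Cor312PinnedRegions
import Summits.ABC.IUTFork.Cor312ThetaSideAssemblyM
import Summits.ABC.IUTFork.Cor312ThetaSideGenuineM
import Summits.ABC.IUTFork.Conditional.AbcOfSGenuineM
import Summits.ABC.IUTFork.Conditional.HexRefutedLe40M
import HarnessLib

/-!
# M LINE — the `«∃ ρ qK, QPinned ∧ PilotKummerCompatHull»` (hull-shape) reading and a GENERIC SOCKET from the M books' (own-idele,
# analytic-log, pinned-q) refuted shape to the hull-shape refutation — the M twin of abc-iut-C-cert-1's K socket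
# `WRow.not_exists_qPinned_and_hull_of_chosen` (`Conditional/WRowN3WholeHull`)

PROOF-ONLY file (D-0012; 0 definitions, 0 `Prop` facts, no instance, no notation) of the abc-iut cell — D-0079 RESCUE sub-cell R-W, seat
abc-iut-W-neg-1 (gen 9), item (ι) «M SOCKET» of RULING C-R166 (c) (pen abc-iut-plan g16). TAKES NO SIDE on [IUTchIII] Cor. 3.12 (S. Mochizuki,
*Inter-universal Teichmüller theory III*, Cor. 3.12 p. 173–174; Step (xi-d) p. 183, (xi-f) p. 184) or on any author; «refuted AS TYPED» over OUR
sharp containers ≠ «refuted in print».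

The M books of branch C (`Conditional.abc_of_SH_v11M_window_szpiroBadAll`, p453767; the `GenuineM.…` refuted-side theorems; conjunct (1) of
abc-iut-W-neg-1 gen 8's `WRowM.hex_whole_le_40_hull_M` and of abc-iut-C-cert-2's `WRowM.n3_whole_M`) read the per-datum object
`S_H := Cor312Vol.PilotKummerCompatHull (LatticeSituation.ofShells (logShellsOfInitialDH T.D (analyticLogvVal T.K)) …)
(settingPrVolSharpM T.D (logvAnalyticVal_analyticLogvVal) (tOfIdeleData T.D (ideleDataOf T.D T.isVolumeInputOf)) (tqM … (ideleDataOf …) ·) …)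
(fun _ => qRegion …) qK` — logs FIXED (c312-5's analytic family at the M level), ideles FIXED (abc-iut-w5-d033's own ideles of the datum),
q-support FIXED (`GenuineM.finite_ratPlaces_under_S`), region operator PINNED to the setting's own q-region. The HULL-SHAPE reading of the K
line (abc-iut-w5-d009 / C-cert-1: `∀ analytic logv, ∀ realising ideles, ∀ column data, ¬ ∃ ρ qK, QPinned ∧ PilotKummerCompatHull`) has the
obvious M twin over abc-iut-s2-p8's summand-route M setting `settingPrVolSharpM T.D hlog (tOfIdeleData T.D r) (tqM … r ·)` in the binders of the
M INHABITED books (`WRowM.licence_*`: every analytic-at-every-prime family `logvK`, every idele datum `r : IdeleData T.D`, every `Sq`/`htq0`/`htq1`)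
plus a column datum `col` and the q-pin `Cor312Vol.QPinned` (abc-iut-w5-d155, generic over any `LatticeSituation`). THIS FILE proves that the
M-books shape IMPLIES the hull shape, for ANY genuine Θ-volume datum `T` (any point, any level):

* §1 `logvVal_eq_analyticLogvVal_of_logvAnalyticVal` — an M-level family of logarithms analytic at (the places over) every rational prime
  (`LogvAnalyticVal`) IS `Real.analyticLogvVal K` (function extensionality over `FinitePlace K`; the rational place under `w` is
  `placeOfPrimeQ (residueChar K 𝔭_w)`). M twin of C-cert-1's `logv_eq_analyticLogv_of_logvAnalytic`. [folklore]
* §2 `settingPrVolSharpM_tOfIdeleData_eq` — ANY two idele data `r`, `r'` of the same initial Θ-datum (and any two q-support sets) give THE SAME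
  summand-route M setting: abc-iut-C-cert-2's `settingPrVolSharpM_eq_of_log_norm_eq` (`Cor312SettingMSharpInvariance`, p-landed, first consumer
  here) at abc-iut-w5-d033's closed forms `log_norm_tThetaM` / `log_norm_tqM` (Dupuy–Hilado (3.4)), which do not read `r`.
* §3 **`WRowM.not_exists_qPinned_and_hull_M_of_chosen`** — THE SOCKET: hypothesis = the M-books refuted shape VERBATIM (so every landed
  `GenuineM.…` theorem and conjunct (1) of `WRowM.hex_whole_le_40_hull_M` / `WRowM.n3_whole_M` plugs in by name); conclusion = the hull shape.
  Proof, line for line the K one: §1 pins the logs, §2 pins the ideles and the q-support, `QPinned` rewrites `ρ qK` to the setting's own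
  q-region (`Eq.subset`), and `PilotKummerCompatHull` does not read the lattice situation's column data (`LatticeSituation.ofShells_toSituation`).
* §4 `WRowM.not_exists_qPinned_and_hull_hex_le_40_M` — first consumer, ONE LINE through §3: the HEX refuted side `k = 1…40` under one name
  (abc-iut-W-neg-1 gen 7's `GenuineM.hex_ref_le_40_M`, p545466, same 40-row `(k, L₀)` literal) in the hull / q-pinned shape — the M twin of the
  K line's `WRow.not_exists_qPinned_and_hull_lamSeven_*` family.
So on the M line, exactly as on the K line, the refuted reading of every row of the window table does not depend on WHICH analytic logarithm
family, WHICH idele datum, WHICH q-support set, WHICH column data or WHICH q-pinned region operator is chosen — the RQ7 question «does the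
hypothesis depend on the choices?» answered NO for the refuted side of the M books.
HONEST SCOPE: OUR sharp containers and Dupuy–Hilado's typed (Ind1)/(Ind2); STRONGER-THAN-PRINT set-level reading of Step (xi-f); a socket /
invariance theorem discharges nothing and changes no census count; admissibility / Szpiro-badness / (P6) / non-emptiness of any datum type NOT
claimed; typed ≠ proved; instantiated ≠ endorsed; no abc claim.
[cite: Mochizuki2012, IUTchI Def. 3.1 (b),(c),(e) pp. 61–62, Ex. 3.2 (iv) p. 71; IUTchIII Def. 1.1 (i) p. 24, Cor. 3.12 p. 173–174, Step (xi-d) p. 183, (xi-f) p. 184; IUTchIV Prop. 1.4 (i)(ii) p. 13]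
[cite: DupuyHilado2025, §3.4, §3.7, §3.9, §4.9] [cite: NeukirchANT1999, Ch. II (5.5)] [claim: Mochizuki2012, status: disputed] for every IUT sentence quoted.
-/

noncomputable section

open Set Function NumberField IsDedekindDomain

namespace Summit.ABC.IUTFork.Thm311.Real

open Cor312 Cor312Vol Literature.IUT.LogThetaLattice Literature.IUT.LogVolume Literature.IUT.HodgeTheaters
  Literature.IUT.LogVolume.ThetaData

/-! ## §1. An M-level family of logarithms analytic at every prime is the analytic one -/

/-- **Uniqueness of the analytic logarithm family, M level.** If `logvK : PadicLogsVal K` is the analytic `p`-adic logarithm at the places of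
`K` over EVERY rational prime (`LogvAnalyticVal`, read at every finite place `u` of `ℚ` through `ratChar u`), then `logvK = Real.analyticLogvVal K`:
at a finite place `w` of `K` both are pinned on `𝒪_w^×` by the same formula, read at the rational place `placeOfPrimeQ (residueChar K 𝔭_w)` under `w`.
M twin of abc-iut-C-cert-1's `Conditional.logv_eq_analyticLogv_of_logvAnalytic`. [cite: NeukirchANT1999, Ch. II (5.5)] [folklore] -/
theorem logvVal_eq_analyticLogvVal_of_logvAnalyticVal {K : Type} [Field K] [NumberField K] {logvK : PadicLogsVal K}
    (hlog : LogvAnalyticVal logvK) : logvK = analyticLogvVal K := by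
  funext w
  refine AddMonoidHom.ext fun x => ?_
  have hpr : (residueChar K (FinitePlace.maximalIdeal w)).Prime := residueChar_prime K (FinitePlace.maximalIdeal w)
  have hw : ((ratChar (placeOfPrimeQ (residueChar K (FinitePlace.maximalIdeal w)) hpr) : ℕ) : 𝓞 K) ∈
      (FinitePlace.maximalIdeal w).asIdeal := by
    rw [ratChar_placeOfPrimeQ]
    exact natCast_residueChar_mem K (FinitePlace.maximalIdeal w)
  have h1 := hlog (placeOfPrimeQ (residueChar K (FinitePlace.maximalIdeal w)) hpr) w hw (Additive.toMul x)
  have h2 := logvAnalyticVal_analyticLogvVal (K := K) (placeOfPrimeQ (residueChar K (FinitePlace.maximalIdeal w)) hpr) w hw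
    (Additive.toMul x)
  simpa using h1.trans h2.symm

/-! ## §2. Any two idele data of an initial Θ-datum give the same summand-route M setting -/

section IdeleData

variable {F K Fbar : Type} [Field F] [NumberField F] [Field K] [NumberField K] [Algebra F K]
  [Field Fbar] [Algebra F Fbar] [Algebra K Fbar] {E : WeierstrassCurve F} [E.IsElliptic] {l : ℕ}
  {Pb : BadPlacePredicates K} (D : InitialThetaData F K Fbar E l Pb) {logvK : PadicLogsVal K}
  (hlog : LogvAnalyticVal logvK) (r r' : ThetaData.IdeleData D)
  (M : Type) [Field M] [NumberField M]
  (archPk : ∀ (j : (thetaIndexOfInitial D).Label) (vQ : (thetaIndexOfInitial D).VQ),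
    Set ((logShellsOfInitialDH D logvK).Packet j vQ))
  (archSub : ∀ (j : (thetaIndexOfInitial D).Label) (v : (thetaIndexOfInitial D).V),
    Set ((logShellsOfInitialDH D logvK).Packet j ((thetaIndexOfInitial D).over v)))
  (Ψ : ℤ → ∀ v : (thetaIndexOfInitial D).V, v ∈ (thetaIndexOfInitial D).Vbad →
    Set ((logShellsOfInitialDH D logvK).StarPacket v))
  (act : ℤ → ∀ v : (thetaIndexOfInitial D).V, v ∈ (thetaIndexOfInitial D).Vbad →
    (logShellsOfInitialDH D logvK).StarPacket v → Module.End ℚ ((logShellsOfInitialDH D logvK).StarPacket v))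
  (Mmod : ℤ → ∀ j : (thetaIndexOfInitial D).LabelStar, Set ((logShellsOfInitialDH D logvK).GlobalPacket j.1))
  (region : ℤ → ∀ j : (thetaIndexOfInitial D).LabelStar, FinDivisor M → ∀ vQ : (thetaIndexOfInitial D).VQ,
    Set ((logShellsOfInitialDH D logvK).Packet j.1 vQ))
  (n : ℤ) {HT : Type} {LogLink : HT → HT → Type} {IsFull : ∀ {s t : HT}, LogLink s t → Prop}
  (lat : LGPGaussianLogThetaLattice LogLink IsFull)
  {Frd : Type} {IsoF : Frd → Frd → Type} {Ob : Frd → Type} {realify : Frd → Frd} {Strip : Type}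
  {IsoS : Strip → Strip → Type} {Mv : ∀ v : (thetaIndexOfInitial D).V, v ∈ (thetaIndexOfInitial D).Vbad → Type}
  [∀ v h, Monoid (Mv v h)]
  (sig : GlobalLGPFrobenioidSignature (thetaIndexOfInitial D).lstar (thetaIndexOfInitial D).V
    (· ∈ (thetaIndexOfInitial D).Vbad) Frd IsoF Ob realify Strip IsoS Mv)
  (split : SplittingMonoids Mv) {ObΔ : Type} {N : ∀ v : (thetaIndexOfInitial D).V, v ∈ (thetaIndexOfInitial D).Vbad → Type}
  [∀ v h, Monoid (N v h)] (qData : QPilotData ObΔ N)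

/-- **ANY TWO IDELE DATA OF THE SAME INITIAL Θ-DATUM GIVE THE SAME SUMMAND-ROUTE M SETTING** (and the q-support set / the unit proofs are
immaterial): abc-iut-w5-d033's ideles `tOfIdeleData D r`, `tqM … r ·` read off ANY `r : IdeleData D` satisfy Dupuy–Hilado's closed forms (3.4)
`log ‖t_{Θ,i+1,v(x)}‖ = −P_{Θ,i+1}(v(x))·ln|κ|/n`, `log ‖t_{q,v(x)}‖ = −P_q(v(x))·ln|κ|/n` (`log_norm_tThetaM`, `log_norm_tqM`), which do not mention
`r`; abc-iut-C-cert-2's `settingPrVolSharpM_eq_of_log_norm_eq` then gives a LITERAL equality of `Cor312.Setting`s (so of `qRegion`, `thetaHull`,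
`Licence`, `PilotKummerCompatHull`, …). As in print: `𝒪_𝕃(−D) := a·𝒪_𝕃` for ANY `a` with `div a = D`; `q̲_v` is ANY `2l`-th root.
[cite: DupuyHilado2025, §3.4, §3.9] [cite: Mochizuki2012, IUTchI Ex. 3.2 (iv) p. 71] -/
theorem settingPrVolSharpM_tOfIdeleData_eq
    (htq0 : ∀ (u : FinitePlace ℚ) (x : (thetaIndexOfInitial D).Fibre (Val.non u)),
      tqM D (ratChar u) u (natCast_ratChar_mem u) r x ≠ 0)
    (htq0' : ∀ (u : FinitePlace ℚ) (x : (thetaIndexOfInitial D).Fibre (Val.non u)),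
      tqM D (ratChar u) u (natCast_ratChar_mem u) r' x ≠ 0)
    (Sq Sq' : Finset (FinitePlace ℚ))
    (htq1 : ∀ (u : FinitePlace ℚ) (x : (thetaIndexOfInitial D).Fibre (Val.non u)), u ∉ Sq →
      ‖tqM D (ratChar u) u (natCast_ratChar_mem u) r x‖ = 1)
    (htq1' : ∀ (u : FinitePlace ℚ) (x : (thetaIndexOfInitial D).Fibre (Val.non u)), u ∉ Sq' →
      ‖tqM D (ratChar u) u (natCast_ratChar_mem u) r' x‖ = 1) :
    settingPrVolSharpM D hlog (tOfIdeleData D r) (fun u x => tqM D (ratChar u) u (natCast_ratChar_mem u) r x) M archPk archSub Ψ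
        act Mmod region n lat sig split qData htq0 Sq htq1 =
      settingPrVolSharpM D hlog (tOfIdeleData D r') (fun u x => tqM D (ratChar u) u (natCast_ratChar_mem u) r' x) M archPk archSub Ψ
        act Mmod region n lat sig split qData htq0' Sq' htq1' :=
  settingPrVolSharpM_eq_of_log_norm_eq D hlog (tOfIdeleData D r) (tOfIdeleData D r')
    (fun u x => tqM D (ratChar u) u (natCast_ratChar_mem u) r x) (fun u x => tqM D (ratChar u) u (natCast_ratChar_mem u) r' x)
    M archPk archSub Ψ act Mmod region n lat sig split qData (tOfIdeleData_ne_zero D r) (tOfIdeleData_ne_zero D r') htq0 htq0' Sq Sq'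
    htq1 htq1' _ _ (fun u i x => log_norm_tThetaM D (ratChar u) u (natCast_ratChar_mem u) r i x)
    (fun u i x => log_norm_tThetaM D (ratChar u) u (natCast_ratChar_mem u) r' i x)
    (fun u x => log_norm_tqM D (ratChar u) u (natCast_ratChar_mem u) r x)
    (fun u x => log_norm_tqM D (ratChar u) u (natCast_ratChar_mem u) r' x)

end IdeleData

end Summit.ABC.IUTFork.Thm311.Real

namespace Summit.ABC.IUTFork.Conditional

open Thm311 Thm311.Real Cor312 Cor312Vol Cor312Prov Literature.IUT.LogThetaLattice Literature.IUT.LogVolume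
  Literature.IUT.HodgeTheaters Literature.IUT.LogVolume.ThetaData Literature.IUT.LogVolume.Cor22
open Literature.NumberTheory.NumberFields Literature.NumberTheory.DiophantineGeometry Literature.NumberTheory.DiophantineGeometry.GenEll

/-! ## §3. The generic M socket: M-books (own-idele, analytic-log, pinned-q) refuted shape ⟹ hull-shape refutation -/

/-- **GENERIC M SOCKET.** For ANY genuine Θ-volume datum `T` (any point, any level): if S_H FAILS in the M books' shape —
`¬ PilotKummerCompatHull` at abc-iut-s2-p8's summand-route M-level sharp setting over c312-5's ANALYTIC logarithms with abc-iut-w5-d033's OWN ideles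
of the datum (`ideleDataOf T.D T.isVolumeInputOf`), the q-support `GenuineM.finite_ratPlaces_under_S`, and the region operator PINNED to the
setting's own q-region, for every context binder, every column-free lattice binder and every Kummer datum `qK` (the shape of every landed
`GenuineM.…` refuted theorem; conjunct (1) of `WRowM.hex_whole_le_40_hull_M` / `WRowM.n3_whole_M`) — then for EVERY analytic-at-every-prime family
`logvK`, EVERY idele datum `r : IdeleData T.D`, EVERY q-support datum `(htq0, Sq, htq1)` and EVERY column datum `col` there is NO `(ρ, qK)` with
`QPinned ∧ PilotKummerCompatHull` at `settingPrVolSharpM T.D hlog (tOfIdeleData T.D r) (tqM … r ·) …`. Proof: `logvK = analyticLogvVal` (§1);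
the setting at `r` is the setting at the own ideles (§2); under `QPinned` the region `ρ qK` IS the setting's q-region; the hull clause does not read
the columns. M twin of abc-iut-C-cert-1's `WRow.not_exists_qPinned_and_hull_of_chosen`.
[cite: Mochizuki2012, IUTchI Def. 3.1 (e) p. 62, Ex. 3.2 (iv) p. 71; IUTchIII Cor. 3.12 Step (xi-d) p. 183, (xi-f) p. 184]
[cite: DupuyHilado2025, §3.4, §3.9, §4.9] [claim: Mochizuki2012, status: disputed] -/
theorem WRowM.not_exists_qPinned_and_hull_M_of_chosen {P : NFPoint} {l : ℕ} (T : Cor22.ThetaVolumeDatumAt P l)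
    (hM :
    letI := T.instFieldF; letI := T.instNumberFieldF; letI := T.instAlgebraF; letI := T.instFieldK
    letI := T.instNumberFieldK; letI := T.instAlgebraK; letI := T.instFieldFbar; letI := T.instAlgebraFbar
    letI := T.instAlgebraKFbar; letI := T.instIsElliptic
    ∀ (M : Type) [Field M] [NumberField M]
      (archPk : ∀ (j : (thetaIndexOfInitial T.D).Label) (vQ : (thetaIndexOfInitial T.D).VQ),
        Set ((logShellsOfInitialDH T.D (analyticLogvVal T.K)).Packet j vQ))
      (archSub : ∀ (j : (thetaIndexOfInitial T.D).Label) (v : (thetaIndexOfInitial T.D).V),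
        Set ((logShellsOfInitialDH T.D (analyticLogvVal T.K)).Packet j ((thetaIndexOfInitial T.D).over v)))
      (Ψ : ℤ → ∀ v : (thetaIndexOfInitial T.D).V, v ∈ (thetaIndexOfInitial T.D).Vbad →
        Set ((logShellsOfInitialDH T.D (analyticLogvVal T.K)).StarPacket v))
      (act : ℤ → ∀ v : (thetaIndexOfInitial T.D).V, v ∈ (thetaIndexOfInitial T.D).Vbad →
        (logShellsOfInitialDH T.D (analyticLogvVal T.K)).StarPacket v →
          Module.End ℚ ((logShellsOfInitialDH T.D (analyticLogvVal T.K)).StarPacket v))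
      (Mmod : ℤ → ∀ j : (thetaIndexOfInitial T.D).LabelStar, Set ((logShellsOfInitialDH T.D (analyticLogvVal T.K)).GlobalPacket j.1))
      (region : ℤ → ∀ j : (thetaIndexOfInitial T.D).LabelStar, FinDivisor M → ∀ vQ : (thetaIndexOfInitial T.D).VQ,
        Set ((logShellsOfInitialDH T.D (analyticLogvVal T.K)).Packet j.1 vQ))
      (frobAdm : ℤ → ℤ → ∀ (j : (thetaIndexOfInitial T.D).Label) (vQ : (thetaIndexOfInitial T.D).VQ),
        Set ((logShellsOfInitialDH T.D (analyticLogvVal T.K)).Packet j vQ) → Prop)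
      (frobLogvol : ℤ → ℤ → ∀ (j : (thetaIndexOfInitial T.D).Label) (vQ : (thetaIndexOfInitial T.D).VQ),
        Set ((logShellsOfInitialDH T.D (analyticLogvVal T.K)).Packet j vQ) → ℝ)
      (frobΨ : ℤ → ℤ → ∀ v : (thetaIndexOfInitial T.D).V, v ∈ (thetaIndexOfInitial T.D).Vbad →
        Set ((logShellsOfInitialDH T.D (analyticLogvVal T.K)).StarPacket v))
      (frobMmod : ℤ → ℤ → ∀ j : (thetaIndexOfInitial T.D).LabelStar, Set ((logShellsOfInitialDH T.D (analyticLogvVal T.K)).GlobalPacket j.1))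
      (unitImage : ℤ → ℤ → ℕ → ∀ (j : (thetaIndexOfInitial T.D).Label) (vQ : (thetaIndexOfInitial T.D).VQ),
        Set ((logShellsOfInitialDH T.D (analyticLogvVal T.K)).Packet j vQ))
      (ballImage : ℤ → ℤ → ∀ (j : (thetaIndexOfInitial T.D).Label) (vQ : (thetaIndexOfInitial T.D).VQ),
        Set ((logShellsOfInitialDH T.D (analyticLogvVal T.K)).Packet j vQ))
      (thetaDiv : ℤ → ℤ → LgpDivisor M (thetaIndexOfInitial T.D).lstar)
      (n : ℤ) {HT : Type} {LogLink : HT → HT → Type} {IsFull : ∀ {s t : HT}, LogLink s t → Prop}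
      (lat : LGPGaussianLogThetaLattice LogLink IsFull)
      {Frd : Type} {IsoF : Frd → Frd → Type} {Ob : Frd → Type} {realify : Frd → Frd} {Strip : Type}
      {IsoS : Strip → Strip → Type} {Mv : ∀ v : (thetaIndexOfInitial T.D).V, v ∈ (thetaIndexOfInitial T.D).Vbad → Type}
      [∀ v h, Monoid (Mv v h)]
      (sig : GlobalLGPFrobenioidSignature (thetaIndexOfInitial T.D).lstar (thetaIndexOfInitial T.D).V
        (· ∈ (thetaIndexOfInitial T.D).Vbad) Frd IsoF Ob realify Strip IsoS Mv)
      (split : SplittingMonoids Mv) {ObΔ : Type} {N : ∀ v : (thetaIndexOfInitial T.D).V, v ∈ (thetaIndexOfInitial T.D).Vbad → Type}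
      [∀ v h, Monoid (N v h)] (qData : QPilotData ObΔ N)
      (qK : ∀ v : (thetaIndexOfInitial T.D).V, v ∈ (thetaIndexOfInitial T.D).Vbad →
        Set ((logShellsOfInitialDH T.D (analyticLogvVal T.K)).StarPacket v)),
      ¬ Cor312Vol.PilotKummerCompatHull
        (LatticeSituation.ofShells (logShellsOfInitialDH T.D (analyticLogvVal T.K)) M archPk archSub
          (summandPiecesPrM T.D (logvAnalyticVal_analyticLogvVal (K := T.K))).Adm
          (summandPiecesPrM T.D (logvAnalyticVal_analyticLogvVal (K := T.K))).logvol Ψ act Mmod region frobAdm frobLogvol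
          frobΨ frobMmod unitImage ballImage thetaDiv)
        (settingPrVolSharpM T.D (logvAnalyticVal_analyticLogvVal (K := T.K)) (tOfIdeleData T.D (ideleDataOf T.D T.isVolumeInputOf))
          (fun u x => tqM T.D (ratChar u) u (natCast_ratChar_mem u) (ideleDataOf T.D T.isVolumeInputOf) x) M archPk archSub Ψ act Mmod
          region n lat sig split qData
          (fun u x => tqM_ne_zero T.D (ratChar u) u (natCast_ratChar_mem u) (ideleDataOf T.D T.isVolumeInputOf) x)
          (GenuineM.finite_ratPlaces_under_S T.D).toFinset
          (fun u x hu => norm_tqM_eq_one_of_not_mem T.D (ratChar u) u (natCast_ratChar_mem u) (ideleDataOf T.D T.isVolumeInputOf) x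
            fun hx => hu ((Set.Finite.mem_toFinset _).mpr ⟨x, hx⟩)))
        (fun _ => Cor312.Setting.qRegion
          (settingPrVolSharpM T.D (logvAnalyticVal_analyticLogvVal (K := T.K)) (tOfIdeleData T.D (ideleDataOf T.D T.isVolumeInputOf))
            (fun u x => tqM T.D (ratChar u) u (natCast_ratChar_mem u) (ideleDataOf T.D T.isVolumeInputOf) x) M archPk archSub Ψ act Mmod
            region n lat sig split qData
            (fun u x => tqM_ne_zero T.D (ratChar u) u (natCast_ratChar_mem u) (ideleDataOf T.D T.isVolumeInputOf) x)
            (GenuineM.finite_ratPlaces_under_S T.D).toFinset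
            (fun u x hu => norm_tqM_eq_one_of_not_mem T.D (ratChar u) u (natCast_ratChar_mem u) (ideleDataOf T.D T.isVolumeInputOf) x
              fun hx => hu ((Set.Finite.mem_toFinset _).mpr ⟨x, hx⟩)))) qK) :
    letI := T.instFieldF; letI := T.instNumberFieldF; letI := T.instAlgebraF; letI := T.instFieldK
    letI := T.instNumberFieldK; letI := T.instAlgebraK; letI := T.instFieldFbar; letI := T.instAlgebraFbar
    letI := T.instAlgebraKFbar; letI := T.instIsElliptic
    ∀ {logvK : PadicLogsVal T.K} (hlog : LogvAnalyticVal logvK) (r : ThetaData.IdeleData T.D) (M : Type) [Field M] [NumberField M]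
      (archPk : ∀ (j : (thetaIndexOfInitial T.D).Label) (vQ : (thetaIndexOfInitial T.D).VQ),
        Set ((logShellsOfInitialDH T.D logvK).Packet j vQ))
      (archSub : ∀ (j : (thetaIndexOfInitial T.D).Label) (v : (thetaIndexOfInitial T.D).V),
        Set ((logShellsOfInitialDH T.D logvK).Packet j ((thetaIndexOfInitial T.D).over v)))
      (Ψ : ℤ → ∀ v : (thetaIndexOfInitial T.D).V, v ∈ (thetaIndexOfInitial T.D).Vbad →
        Set ((logShellsOfInitialDH T.D logvK).StarPacket v))
      (act : ℤ → ∀ v : (thetaIndexOfInitial T.D).V, v ∈ (thetaIndexOfInitial T.D).Vbad →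
        (logShellsOfInitialDH T.D logvK).StarPacket v → Module.End ℚ ((logShellsOfInitialDH T.D logvK).StarPacket v))
      (Mmod : ℤ → ∀ j : (thetaIndexOfInitial T.D).LabelStar, Set ((logShellsOfInitialDH T.D logvK).GlobalPacket j.1))
      (region : ℤ → ∀ j : (thetaIndexOfInitial T.D).LabelStar, FinDivisor M → ∀ vQ : (thetaIndexOfInitial T.D).VQ,
        Set ((logShellsOfInitialDH T.D logvK).Packet j.1 vQ))
      (n : ℤ) {HT : Type} {LogLink : HT → HT → Type} {IsFull : ∀ {s t : HT}, LogLink s t → Prop}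
      (lat : LGPGaussianLogThetaLattice LogLink IsFull)
      {Frd : Type} {IsoF : Frd → Frd → Type} {Ob : Frd → Type} {realify : Frd → Frd} {Strip : Type}
      {IsoS : Strip → Strip → Type}
      {Mv : ∀ v : (thetaIndexOfInitial T.D).V, v ∈ (thetaIndexOfInitial T.D).Vbad → Type} [∀ v h, Monoid (Mv v h)]
      (sig : GlobalLGPFrobenioidSignature (thetaIndexOfInitial T.D).lstar (thetaIndexOfInitial T.D).V
        (· ∈ (thetaIndexOfInitial T.D).Vbad) Frd IsoF Ob realify Strip IsoS Mv)
      (split : SplittingMonoids Mv) {ObΔ : Type}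
      {N : ∀ v : (thetaIndexOfInitial T.D).V, v ∈ (thetaIndexOfInitial T.D).Vbad → Type} [∀ v h, Monoid (N v h)]
      (qData : QPilotData ObΔ N)
      (htq0 : ∀ (u : FinitePlace ℚ) (x : (thetaIndexOfInitial T.D).Fibre (Val.non u)),
        tqM T.D (ratChar u) u (natCast_ratChar_mem u) r x ≠ 0)
      (Sq : Finset (FinitePlace ℚ))
      (htq1 : ∀ (u : FinitePlace ℚ) (x : (thetaIndexOfInitial T.D).Fibre (Val.non u)), u ∉ Sq →
        ‖tqM T.D (ratChar u) u (natCast_ratChar_mem u) r x‖ = 1)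
      (col : ℤ → Column (logShellsOfInitialDH T.D logvK)),
      ¬ ∃ (ρ : (∀ v : (thetaIndexOfInitial T.D).V, v ∈ (thetaIndexOfInitial T.D).Vbad →
              Set ((logShellsOfInitialDH T.D logvK).StarPacket v)) →
            ∀ (j : (thetaIndexOfInitial T.D).Label) (vQ : (thetaIndexOfInitial T.D).VQ),
              Set ((logShellsOfInitialDH T.D logvK).Packet j vQ))
          (qK : ∀ v : (thetaIndexOfInitial T.D).V, v ∈ (thetaIndexOfInitial T.D).Vbad →
            Set ((logShellsOfInitialDH T.D logvK).StarPacket v)),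
          QPinned ({ toSituation := situationPrVolM T.D hlog M archPk archSub Ψ act Mmod region, col := col } :
              LatticeSituation (thetaIndexOfInitial T.D))
            (settingPrVolSharpM T.D hlog (tOfIdeleData T.D r) (fun u x => tqM T.D (ratChar u) u (natCast_ratChar_mem u) r x) M archPk
              archSub Ψ act Mmod region n lat sig split qData htq0 Sq htq1) ρ qK ∧
          PilotKummerCompatHull ({ toSituation := situationPrVolM T.D hlog M archPk archSub Ψ act Mmod region, col := col } :
              LatticeSituation (thetaIndexOfInitial T.D))
            (settingPrVolSharpM T.D hlog (tOfIdeleData T.D r) (fun u x => tqM T.D (ratChar u) u (natCast_ratChar_mem u) r x) M archPk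
              archSub Ψ act Mmod region n lat sig split qData htq0 Sq htq1) ρ qK := by
  letI := T.instFieldF; letI := T.instNumberFieldF; letI := T.instAlgebraF; letI := T.instFieldK
  letI := T.instNumberFieldK; letI := T.instAlgebraK; letI := T.instFieldFbar; letI := T.instAlgebraFbar
  letI := T.instAlgebraKFbar; letI := T.instIsElliptic
  intro logvK hlog r M _ _ archPk archSub Ψ act Mmod region n HT LogLink IsFull lat Frd IsoF Ob realify Strip IsoS Mv _ sig split ObΔ N _
    qData htq0 Sq htq1 col
  obtain rfl : logvK = analyticLogvVal T.K := logvVal_eq_analyticLogvVal_of_logvAnalyticVal hlog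
  rw [settingPrVolSharpM_tOfIdeleData_eq T.D hlog r (ideleDataOf T.D T.isVolumeInputOf) M archPk archSub Ψ act Mmod region n lat sig split
    qData htq0 (fun u x => tqM_ne_zero T.D (ratChar u) u (natCast_ratChar_mem u) (ideleDataOf T.D T.isVolumeInputOf) x) Sq
    (GenuineM.finite_ratPlaces_under_S T.D).toFinset htq1
    (fun u x hu => norm_tqM_eq_one_of_not_mem T.D (ratChar u) u (natCast_ratChar_mem u) (ideleDataOf T.D T.isVolumeInputOf) x
      fun hx => hu ((Set.Finite.mem_toFinset _).mpr ⟨x, hx⟩))]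
  rintro ⟨ρ, qK, hq, hc⟩
  exact hM M archPk archSub Ψ act Mmod region (fun n m => (col n).frobAdm m) (fun n m => (col n).frobLogvol m) (fun n m => (col n).frobΨ m)
    (fun n m => (col n).frobMmod m) (fun n m => (col n).unitImage m) (fun n m => (col n).ballImage m) (fun _ _ => 0) n lat sig split qData qK
    (fun j vQ => Set.Subset.trans (hq j vQ).subset (hc j vQ))

/-! ## §4. First consumer: the HEX refuted side `k = 1…40` under ONE name, in the hull / q-pinned shape (M line) -/

/-- **«HEX REFUTED SIDE, M LINE, k = 1…40 UNDER ONE NAME», hull / q-pinned shape** — the M twin of the K line's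
`WRow.not_exists_qPinned_and_hull_lamSeven_*` family under one name: for every row `(k, L₀)` of the 40-row list literal (VERBATIM that of
abc-iut-W-neg-1 gen 7's `GenuineM.hex_ref_le_40_M`, p545466 = the `(k, L₀)` columns of `WRow.hex_whole_le_40`), every prime `11 ≤ l ≤ L₀` and every
genuine Θ-volume datum `T` over `(ratPoint (1/2 + 2/7^k), l)`: for EVERY analytic-at-every-prime log family, EVERY idele datum, EVERY q-support
datum and EVERY column datum, `¬ ∃ ρ qK, QPinned ∧ PilotKummerCompatHull` at the summand-route M setting. ONE LINE: `GenuineM.hex_ref_le_40_M`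
through the socket §3 (so the plug fits the M books' shape byte for byte). Rows `k ≤ 7` (`L₀ = 10 < 11`) are VACUOUS AS TYPED, as in the
K and M one-name files. Packaging — discharges nothing, changes no census count. [cite: Mochizuki2012, IUTchI Def. 3.1 (b),(c) pp. 61–62, Ex. 3.2 (iv) p. 71; IUTchIII Cor. 3.12 Step (xi-d) p. 183, (xi-f) p. 184; IUTchIV Prop. 1.4 (i)(ii) p. 13]
[cite: DupuyHilado2025, §3.4, §3.9, §4.9, §4.12] [claim: Mochizuki2012, status: disputed] -/
theorem WRowM.not_exists_qPinned_and_hull_hex_le_40_M {k L0 l : ℕ}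
    (hmem : (k, L0) ∈ ([(1, 10), (2, 10), (3, 10), (4, 10), (5, 10), (6, 10), (7, 10), (8, 71), (9, 337), (10, 4721), (11, 811), (12, 20063), (13, 5851), (14, 46933), (15, 617587), (16, 329269), (17, 288203), (18, 6917593), (19, 2017637), (20, 80707019), (21, 42371239), (22, 112989881), (23, 98866283), (24, 2372791879), (25, 3460321741), (26, 5536514639), (27, 14533351453), (28, 38755603903), (29, 33911153561), (30, 4069338436799), (31, 237378075419), (32, 1899024603689), (33, 4984939585357), (34, 13293172227497), (35, 58157628496679), (36, 279156616784327), (37, 81420679895431), (38, 651365439163823), (39, 1709834277805873), (40, 22797790370745883)] : List (ℕ × ℕ)))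
    (hl : l.Prime) (h11 : 11 ≤ l) (hL0 : l ≤ L0)
    (T : Cor22.ThetaVolumeDatumAt (ratPoint ((2 : ℚ)⁻¹ + 2 / 7 ^ k)) l) :
    letI := T.instFieldF; letI := T.instNumberFieldF; letI := T.instAlgebraF; letI := T.instFieldK
    letI := T.instNumberFieldK; letI := T.instAlgebraK; letI := T.instFieldFbar; letI := T.instAlgebraFbar
    letI := T.instAlgebraKFbar; letI := T.instIsElliptic
    ∀ {logvK : PadicLogsVal T.K} (hlog : LogvAnalyticVal logvK) (r : ThetaData.IdeleData T.D) (M : Type) [Field M] [NumberField M]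
      (archPk : ∀ (j : (thetaIndexOfInitial T.D).Label) (vQ : (thetaIndexOfInitial T.D).VQ),
        Set ((logShellsOfInitialDH T.D logvK).Packet j vQ))
      (archSub : ∀ (j : (thetaIndexOfInitial T.D).Label) (v : (thetaIndexOfInitial T.D).V),
        Set ((logShellsOfInitialDH T.D logvK).Packet j ((thetaIndexOfInitial T.D).over v)))
      (Ψ : ℤ → ∀ v : (thetaIndexOfInitial T.D).V, v ∈ (thetaIndexOfInitial T.D).Vbad →
        Set ((logShellsOfInitialDH T.D logvK).StarPacket v))
      (act : ℤ → ∀ v : (thetaIndexOfInitial T.D).V, v ∈ (thetaIndexOfInitial T.D).Vbad →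
        (logShellsOfInitialDH T.D logvK).StarPacket v → Module.End ℚ ((logShellsOfInitialDH T.D logvK).StarPacket v))
      (Mmod : ℤ → ∀ j : (thetaIndexOfInitial T.D).LabelStar, Set ((logShellsOfInitialDH T.D logvK).GlobalPacket j.1))
      (region : ℤ → ∀ j : (thetaIndexOfInitial T.D).LabelStar, FinDivisor M → ∀ vQ : (thetaIndexOfInitial T.D).VQ,
        Set ((logShellsOfInitialDH T.D logvK).Packet j.1 vQ))
      (n : ℤ) {HT : Type} {LogLink : HT → HT → Type} {IsFull : ∀ {s t : HT}, LogLink s t → Prop}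
      (lat : LGPGaussianLogThetaLattice LogLink IsFull)
      {Frd : Type} {IsoF : Frd → Frd → Type} {Ob : Frd → Type} {realify : Frd → Frd} {Strip : Type}
      {IsoS : Strip → Strip → Type}
      {Mv : ∀ v : (thetaIndexOfInitial T.D).V, v ∈ (thetaIndexOfInitial T.D).Vbad → Type} [∀ v h, Monoid (Mv v h)]
      (sig : GlobalLGPFrobenioidSignature (thetaIndexOfInitial T.D).lstar (thetaIndexOfInitial T.D).V
        (· ∈ (thetaIndexOfInitial T.D).Vbad) Frd IsoF Ob realify Strip IsoS Mv)
      (split : SplittingMonoids Mv) {ObΔ : Type}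
      {N : ∀ v : (thetaIndexOfInitial T.D).V, v ∈ (thetaIndexOfInitial T.D).Vbad → Type} [∀ v h, Monoid (N v h)]
      (qData : QPilotData ObΔ N)
      (htq0 : ∀ (u : FinitePlace ℚ) (x : (thetaIndexOfInitial T.D).Fibre (Val.non u)),
        tqM T.D (ratChar u) u (natCast_ratChar_mem u) r x ≠ 0)
      (Sq : Finset (FinitePlace ℚ))
      (htq1 : ∀ (u : FinitePlace ℚ) (x : (thetaIndexOfInitial T.D).Fibre (Val.non u)), u ∉ Sq →
        ‖tqM T.D (ratChar u) u (natCast_ratChar_mem u) r x‖ = 1)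
      (col : ℤ → Column (logShellsOfInitialDH T.D logvK)),
      ¬ ∃ (ρ : (∀ v : (thetaIndexOfInitial T.D).V, v ∈ (thetaIndexOfInitial T.D).Vbad →
              Set ((logShellsOfInitialDH T.D logvK).StarPacket v)) →
            ∀ (j : (thetaIndexOfInitial T.D).Label) (vQ : (thetaIndexOfInitial T.D).VQ),
              Set ((logShellsOfInitialDH T.D logvK).Packet j vQ))
          (qK : ∀ v : (thetaIndexOfInitial T.D).V, v ∈ (thetaIndexOfInitial T.D).Vbad →
            Set ((logShellsOfInitialDH T.D logvK).StarPacket v)),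
          QPinned ({ toSituation := situationPrVolM T.D hlog M archPk archSub Ψ act Mmod region, col := col } :
              LatticeSituation (thetaIndexOfInitial T.D))
            (settingPrVolSharpM T.D hlog (tOfIdeleData T.D r) (fun u x => tqM T.D (ratChar u) u (natCast_ratChar_mem u) r x) M archPk
              archSub Ψ act Mmod region n lat sig split qData htq0 Sq htq1) ρ qK ∧
          PilotKummerCompatHull ({ toSituation := situationPrVolM T.D hlog M archPk archSub Ψ act Mmod region, col := col } :
              LatticeSituation (thetaIndexOfInitial T.D))
            (settingPrVolSharpM T.D hlog (tOfIdeleData T.D r) (fun u x => tqM T.D (ratChar u) u (natCast_ratChar_mem u) r x) M archPk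
              archSub Ψ act Mmod region n lat sig split qData htq0 Sq htq1) ρ qK :=
  WRowM.not_exists_qPinned_and_hull_M_of_chosen T (GenuineM.hex_ref_le_40_M hmem hl h11 hL0 T)

end Summit.ABC.IUTFork.Conditional

end
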